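import Literature.MathematicalPhysics.QuantumFieldTheory.Balaban1983to89.B11Eq103H1Complex

/-!
# `Balaban1983to89.B11Eq103H1ComplexReality` — [B11] (51) p. 286 «for `A′` with values in `𝔤` the configuration has values in `𝔤`»:
# REALITY ∕ SECTOR PRESERVATION of the CONSTRUCTED operators `Δ_a`, `G₁ = Δ_a⁻¹`, `(QG₁Q*)⁻¹`, `H₁ = G₁Q*(QG₁Q*)⁻¹`, `R`, `𝔓`, `𝔊`
# of `B11Eq103H1Complex` ∕ `B11Eq111FrakG`, from the same property of their DATA — generic finite-dimensional Hilbert-space algebra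

T. Bałaban, *The variational problem and background fields in renormalization group method for lattice gauge theories*, Commun. Math. Phys.
**102** (1985) 277–309 [`Balaban1985Variational`, "B11"]; *Propagators for lattice gauge theories in a background field*, Commun. Math. Phys.
**99** (1985) 389–434 [`Balaban1985BackgroundPropagators`, "B9"].

statement-level skeleton of published theorems with citation tags; proofs where landed; nothing here is a claim about the Yang–Mills mass gap

THE PRINTED LOCUS.  [B11] p. 286, after (50)–(51): *«We consider configurations A′, X with values in the complexified Lie algebra 𝔤ᶜ … for A′
with values in 𝔤 the configuration D(A′) has values in 𝔤 also»*; [B9] p. 393: the operators of Sect. 3 act on `𝔤ᶜ`-valued functions and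
are REAL (they commute with the conjugation of `𝔤ᶜ = 𝔤 ⊕ i𝔤`), so that `H(U₀) = GQ*(QGQ*)⁻¹` (3.126), `H₁(U₀)` (3.129), `𝔓` (3.147), `𝔊 = G₁𝔓*`
(3.153) map `𝔤`-valued data to `𝔤`-valued fields.  In `B11Eq103H1Complex` these operators are CONSTRUCTED over an abstract `RCLike 𝕜`
Hilbert space from the data `Δ, D, R, D*, Q, Q*, a` (`greenK`, `laplaceAK`, `G1K`, `KinvK`, `H1K`, `projR`; `B11Eq111FrakG.frakPLin`,
`frakGLin`).  This file proves, ONCE, the algebra that transports «reality» from the data to the constructed operators, in the two forms a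
consumer meets: (a) COMMUTATION WITH A (CONJUGATE-)LINEAR ISOMETRIC INVOLUTION `σ` (the conjugation `X ↦ X*` of `𝔤ᶜ ⊆ M_N(ℂ)`, anti-unitary
for `⟨X, Y⟩ = tr X*Y`; or a unitary involution such as the reflection in a sector), and (b) PRESERVATION OF A `𝕜`-SUBSPACE `V` (a «sector»,
e.g. the traceless fields `𝔰𝔩 ⊆ 𝔤𝔩`).  The maps `σ` are taken as PLAIN FUNCTIONS with the two or three properties each lemma uses (additivity,
involutivity, `⟨σx, σy⟩ = ⟨y, x⟩` resp. `= ⟨x, y⟩`) — no new structure, no definition.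

WHAT IS PROVED (sorry-free, no definition).
* §1 (inverses) `greenK_map_comm` — `T∘σ = σ∘T ⟹ T⁻¹∘σ = σ∘T⁻¹` (injectivity of `T`); `greenK_mem_of_mapsTo` — `T(V) ⊆ V ⟹ T⁻¹(V) ⊆ V`
  (finite dimension: `T|_V` injective hence onto `V`).
* §2 (adjoints) `adjoint_map_comm_of_anti` ∕ `adjoint_map_comm_of_iso` — `T∘σ_E = σ_F∘T ⟹ T†∘σ_F = σ_E∘T†` for anti-unitary resp. unitary
  involutions; `adjoint_mem_of_mapsTo_orthogonal` — `T(Vᗮ) ⊆ V′ᗮ ⟹ T†(V′) ⊆ V` (the sector form; NB it is `Vᗮ`, not `V`, that `T` must respect).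
* §3 (projections) `starProjection_map_comm_of_anti` ∕ `_of_iso` — an orthogonal projection commutes with an (anti-)unitary additive involution
  mapping its range into itself; `projR_map_comm_of_anti` ∕ `_of_iso` for `projR Δs Q′` (3.21) from `Δs∘σ = σ∘Δs` and `Q′λ = 0 ⟹ Q′(σλ) = 0`.
* §4 (the constructed operators) `laplaceAK_map_comm`, `G1K_map_comm`, `KinvK_map_comm`, `H1K_map_comm`, `frakPLin_map_comm`, `frakGLin_map_comm`
  — each from the commutation of its data (and `σ_F(a•y) = a•σ_F y`, i.e. `a` real for an anti-linear `σ_F`); `laplaceAK_mem_of_mapsTo`,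
  `G1K_mem_of_mapsTo`, `KinvK_mem_of_mapsTo`, `H1K_mem_of_mapsTo` — the sector forms.
* §5 (reading) `mem_of_reflection_comm` — a map intertwining the REFLECTIONS of two sectors maps the one into the other; so the `_of_iso`
  lemmas at `σ := Submodule.reflection V` are a second road to the sector statements.

HONEST SCOPE.  [folklore]-level linear algebra, cited to the printed sentence it serves; nothing of the papers' estimates; no statement about
any concrete averaging operator `Q` (whose reality on BOTH sectors of `M_N(ℂ) = 𝔰𝔩_N ⊕ ℂ·1` is the consumer's input — cell `pub/ym-inputs` memo
`REALITY-ROWS-LOCATE-p03g2.md` §3); count-neutral; NOT summit progress.  Seat `ym-inputs-p03` gen 2 (prover-ym-inputs-p03-g2-0), 2026-08-28;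
NEW file importing `B11Eq103H1Complex` only; nothing of the `b2b-balaban` ∕ lit-balaban lineages' files is modified.
-/

noncomputable section

open scoped InnerProductSpace ComplexConjugate

namespace Literature.MathematicalPhysics.QuantumFieldTheory.Balaban1983to89.B11Eq103H1ComplexReality

open Literature.MathematicalPhysics.QuantumFieldTheory.Balaban1983to89
open B11Eq103H1Complex B11Eq111FrakG

/-! ## §1 Inverses: `greenK` commutes with whatever `T` commutes with, and preserves every sector `T` preserves -/

section Green

variable {𝕜 : Type*} [RCLike 𝕜] {E : Type*} [NormedAddCommGroup E] [InnerProductSpace 𝕜 E] [FiniteDimensional 𝕜 E]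
variable {T : E →ₗ[𝕜] E} (hpos : ∀ x : E, x ≠ 0 → 0 < RCLike.re ⟪x, T x⟫_𝕜)

/-- **`T∘σ = σ∘T ⟹ T⁻¹∘σ = σ∘T⁻¹`** for ANY map `σ : E → E` (no linearity needed: apply `T` to both sides and use injectivity).  At `σ` = the
conjugation of `𝔤ᶜ` this is «the Green operator of a real operator is real», [B9] p. 393 ∕ [B11] (51).
[cite: Balaban1985Variational, (51) p.286; Balaban1985BackgroundPropagators, Thm 3.11 p.416] -/
theorem greenK_map_comm (σ : E → E) (hσ : ∀ x, T (σ x) = σ (T x)) (y : E) : greenK T hpos (σ y) = σ (greenK T hpos y) := by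
  apply injective_of_rePosDef hpos
  rw [apply_greenK, hσ, apply_greenK]

/-- **`T(V) ⊆ V ⟹ T⁻¹(V) ⊆ V`** for a `𝕜`-subspace `V` (a «sector»: e.g. the traceless fields): `T|_V : V → V` is injective, hence onto `V` in
finite dimension, so the preimage of `y ∈ V` lies in `V`.  [cite: Balaban1985Variational, (51) p.286; Balaban1985BackgroundPropagators, p.393] -/
theorem greenK_mem_of_mapsTo (V : Submodule 𝕜 E) (hV : ∀ x ∈ V, T x ∈ V) {y : E} (hy : y ∈ V) : greenK T hpos y ∈ V := by
  have hinj : Function.Injective (T.restrict hV) := by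
    intro a b hab
    apply Subtype.ext
    apply injective_of_rePosDef hpos
    have h := congrArg Subtype.val hab
    simpa only [LinearMap.coe_restrict_apply] using h
  obtain ⟨x, hx⟩ := LinearMap.surjective_of_injective hinj ⟨y, hy⟩
  have hTx : T (x : E) = y := by
    have h := congrArg Subtype.val hx
    simpa only [LinearMap.coe_restrict_apply] using h
  rw [← hTx, greenK_apply]
  exact x.2

end Green

/-! ## §2 Adjoints: `T†` inherits the intertwining of (anti-)unitary involutions, and the ORTHOGONAL sector condition -/

section Adjoint

variable {𝕜 : Type*} [RCLike 𝕜] {E F : Type*} [NormedAddCommGroup E] [InnerProductSpace 𝕜 E] [NormedAddCommGroup F] [InnerProductSpace 𝕜 F]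
  [FiniteDimensional 𝕜 E] [FiniteDimensional 𝕜 F]

/-- **ADJOINTS OF REAL OPERATORS ARE REAL (anti-unitary involutions)**: if `σ_E`, `σ_F` are involutions with `⟨σx, σy⟩ = ⟨y, x⟩` (the conjugation
`X ↦ X*` of `𝔤ᶜ` for `⟨X, Y⟩ = tr X*Y`, extended pointwise and summed with real weights) and `T∘σ_E = σ_F∘T`, then `T†∘σ_F = σ_E∘T†` — print's
«Q* … taken with respect to natural L² scalar products» is real with `Q`. [cite: Balaban1985BackgroundPropagators, p.391, p.393; Balaban1985Variational, (51) p.286] -/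
theorem adjoint_map_comm_of_anti (T : E →ₗ[𝕜] F) (σE : E → E) (σF : F → F)
    (hσE : ∀ x y : E, ⟪σE x, σE y⟫_𝕜 = ⟪y, x⟫_𝕜) (hσE2 : ∀ x, σE (σE x) = x)
    (hσF : ∀ x y : F, ⟪σF x, σF y⟫_𝕜 = ⟪y, x⟫_𝕜) (hσF2 : ∀ y, σF (σF y) = y)
    (hT : ∀ x, T (σE x) = σF (T x)) (y : F) :
    LinearMap.adjoint T (σF y) = σE (LinearMap.adjoint T y) := by
  refine ext_inner_left 𝕜 fun x => ?_
  rw [LinearMap.adjoint_inner_right]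
  calc ⟪T x, σF y⟫_𝕜 = ⟪σF (σF (T x)), σF y⟫_𝕜 := by rw [hσF2]
    _ = ⟪y, σF (T x)⟫_𝕜 := hσF _ _
    _ = ⟪y, T (σE x)⟫_𝕜 := by rw [hT]
    _ = ⟪LinearMap.adjoint T y, σE x⟫_𝕜 := (LinearMap.adjoint_inner_left _ _ _).symm
    _ = ⟪σE (σE x), σE (LinearMap.adjoint T y)⟫_𝕜 := (hσE _ _).symm
    _ = ⟪x, σE (LinearMap.adjoint T y)⟫_𝕜 := by rw [hσE2]

/-- **ADJOINTS INTERTWINE UNITARY INVOLUTIONS THE MAP INTERTWINES**: `⟨σx, σy⟩ = ⟨x, y⟩`, `σ∘σ = id`, `T∘σ_E = σ_F∘T ⟹ T†∘σ_F = σ_E∘T†` (e.g. `σ`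
= the reflection `2P_V − 1` of a sector `V`: «`T` respects the sectors» passes to `T†`). [cite: Balaban1985BackgroundPropagators, p.391; Balaban1985Variational, (51) p.286] -/
theorem adjoint_map_comm_of_iso (T : E →ₗ[𝕜] F) (σE : E → E) (σF : F → F)
    (hσE : ∀ x y : E, ⟪σE x, σE y⟫_𝕜 = ⟪x, y⟫_𝕜) (hσE2 : ∀ x, σE (σE x) = x)
    (hσF : ∀ x y : F, ⟪σF x, σF y⟫_𝕜 = ⟪x, y⟫_𝕜) (hσF2 : ∀ y, σF (σF y) = y)
    (hT : ∀ x, T (σE x) = σF (T x)) (y : F) :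
    LinearMap.adjoint T (σF y) = σE (LinearMap.adjoint T y) := by
  refine ext_inner_left 𝕜 fun x => ?_
  rw [LinearMap.adjoint_inner_right]
  calc ⟪T x, σF y⟫_𝕜 = ⟪σF (σF (T x)), σF y⟫_𝕜 := by rw [hσF2]
    _ = ⟪σF (T x), y⟫_𝕜 := hσF _ _
    _ = ⟪T (σE x), y⟫_𝕜 := by rw [hT]
    _ = ⟪σE x, LinearMap.adjoint T y⟫_𝕜 := (LinearMap.adjoint_inner_right _ _ _).symm
    _ = ⟪σE (σE x), σE (LinearMap.adjoint T y)⟫_𝕜 := (hσE _ _).symm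
    _ = ⟪x, σE (LinearMap.adjoint T y)⟫_𝕜 := by rw [hσE2]

/-- **THE SECTOR FORM FOR ADJOINTS**: `T(Vᗮ) ⊆ V′ᗮ ⟹ T†(V′) ⊆ V` — for `T†y` (`y ∈ V′`) to lie in `V = Vᗮᗮ` one needs `⟨u, T†y⟩ = ⟨Tu, y⟩ = 0` for
`u ∈ Vᗮ`, i.e. `T` must respect the COMPLEMENTARY sector (for `𝔤𝔩 = 𝔰𝔩 ⊕ ℂ·1`: the scalar fields); `T(V) ⊆ V′` alone does not suffice
(`T = [[1,1],[0,0]]` on `𝕜²`, `V = V′ = 𝕜·e₁`). [cite: Balaban1985BackgroundPropagators, p.391, p.393; Balaban1985Variational, (51) p.286] -/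
theorem adjoint_mem_of_mapsTo_orthogonal (T : E →ₗ[𝕜] F) (V : Submodule 𝕜 E) (V' : Submodule 𝕜 F) (h : ∀ u ∈ Vᗮ, T u ∈ V'ᗮ)
    {y : F} (hy : y ∈ V') : LinearMap.adjoint T y ∈ V := by
  haveI : CompleteSpace V := FiniteDimensional.complete 𝕜 V
  rw [← Submodule.orthogonal_orthogonal V, Submodule.mem_orthogonal]
  intro u hu
  rw [LinearMap.adjoint_inner_right]
  exact Submodule.inner_left_of_mem_orthogonal hy (h u hu)

end Adjoint

/-! ## §3 Orthogonal projections (`projR` of (3.21)) -/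

section Projection

variable {𝕜 : Type*} [RCLike 𝕜] {E : Type*} [NormedAddCommGroup E] [InnerProductSpace 𝕜 E]

/-- **AN ORTHOGONAL PROJECTION COMMUTES WITH AN ANTI-UNITARY ADDITIVE INVOLUTION MAPPING ITS RANGE INTO ITSELF** (then it maps the orthogonal
complement into itself too, and `P(σx) = P(σ(Px) + σ(x − Px)) = σ(Px)`). [cite: Balaban1985BackgroundPropagators, (3.21) p.394, p.393] -/
theorem starProjection_map_comm_of_anti (K : Submodule 𝕜 E) [K.HasOrthogonalProjection] (σ : E → E)
    (hadd : ∀ x y, σ (x + y) = σ x + σ y) (hσ : ∀ x y : E, ⟪σ x, σ y⟫_𝕜 = ⟪y, x⟫_𝕜) (hσ2 : ∀ x, σ (σ x) = x)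
    (hK : ∀ k ∈ K, σ k ∈ K) (x : E) : K.starProjection (σ x) = σ (K.starProjection x) := by
  have hK' : ∀ u ∈ Kᗮ, σ u ∈ Kᗮ := by
    intro u hu
    rw [Submodule.mem_orthogonal]
    intro k hk
    calc ⟪k, σ u⟫_𝕜 = ⟪σ (σ k), σ u⟫_𝕜 := by rw [hσ2]
      _ = ⟪u, σ k⟫_𝕜 := hσ _ _
      _ = 0 := Submodule.inner_left_of_mem_orthogonal (hK k hk) hu
  have hx : σ x = σ (K.starProjection x) + σ (x - K.starProjection x) := by
    rw [← hadd, add_sub_cancel]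
  rw [hx, map_add, Submodule.starProjection_eq_self_iff.2 (hK _ (K.starProjection_apply_mem x)),
    K.starProjection_apply_eq_zero_iff.2 (hK' _ (K.sub_starProjection_mem_orthogonal x)), add_zero]

/-- **AN ORTHOGONAL PROJECTION COMMUTES WITH A UNITARY ADDITIVE INVOLUTION MAPPING ITS RANGE INTO ITSELF.**
[cite: Balaban1985BackgroundPropagators, (3.21) p.394, p.393] -/
theorem starProjection_map_comm_of_iso (K : Submodule 𝕜 E) [K.HasOrthogonalProjection] (σ : E → E)
    (hadd : ∀ x y, σ (x + y) = σ x + σ y) (hσ : ∀ x y : E, ⟪σ x, σ y⟫_𝕜 = ⟪x, y⟫_𝕜) (hσ2 : ∀ x, σ (σ x) = x)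
    (hK : ∀ k ∈ K, σ k ∈ K) (x : E) : K.starProjection (σ x) = σ (K.starProjection x) := by
  have hK' : ∀ u ∈ Kᗮ, σ u ∈ Kᗮ := by
    intro u hu
    rw [Submodule.mem_orthogonal]
    intro k hk
    calc ⟪k, σ u⟫_𝕜 = ⟪σ (σ k), σ u⟫_𝕜 := by rw [hσ2]
      _ = ⟪σ k, u⟫_𝕜 := hσ _ _
      _ = 0 := Submodule.inner_right_of_mem_orthogonal (hK k hk) hu
  have hx : σ x = σ (K.starProjection x) + σ (x - K.starProjection x) := by
    rw [← hadd, add_sub_cancel]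
  rw [hx, map_add, Submodule.starProjection_eq_self_iff.2 (hK _ (K.starProjection_apply_mem x)),
    K.starProjection_apply_eq_zero_iff.2 (hK' _ (K.sub_starProjection_mem_orthogonal x)), add_zero]

variable [FiniteDimensional 𝕜 E] {F' : Type*} [AddCommGroup F'] [Module 𝕜 F']

/-- **`R` OF (3.21) IS REAL WITH ITS DATA (anti-unitary form)**: if `Δ^η_U` commutes with `σ` and `N(Q′)` is `σ`-stable (`Q′λ = 0 ⟹ Q′(σλ) = 0`),
then `projR Δs Q′ ∘ σ = σ ∘ projR Δs Q′`. [cite: Balaban1985BackgroundPropagators, (3.20)–(3.23) p.394, p.393] -/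
theorem projR_map_comm_of_anti (Δs : E →ₗ[𝕜] E) (Q' : E →ₗ[𝕜] F') (σ : E → E)
    (hadd : ∀ x y, σ (x + y) = σ x + σ y) (hσ : ∀ x y : E, ⟪σ x, σ y⟫_𝕜 = ⟪y, x⟫_𝕜) (hσ2 : ∀ x, σ (σ x) = x)
    (hΔ : ∀ x, Δs (σ x) = σ (Δs x)) (hQ : ∀ l, Q' l = 0 → Q' (σ l) = 0) (x : E) :
    projR Δs Q' (σ x) = σ (projR Δs Q' x) := by
  haveI : CompleteSpace ((LinearMap.ker Q').map Δs) := FiniteDimensional.complete 𝕜 _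
  have hK : ∀ k ∈ (LinearMap.ker Q').map Δs, σ k ∈ (LinearMap.ker Q').map Δs := by
    intro k hk
    obtain ⟨l, hl, rfl⟩ := Submodule.mem_map.1 hk
    exact Submodule.mem_map.2 ⟨σ l, LinearMap.mem_ker.2 (hQ l (LinearMap.mem_ker.1 hl)), (hΔ l).symm ▸ rfl⟩
  exact starProjection_map_comm_of_anti _ σ hadd hσ hσ2 hK x

/-- **`R` OF (3.21) RESPECTS WHAT ITS DATA RESPECT (unitary form)** — e.g. `σ` = the reflection of a sector stable under `Δ^η_U` and `N(Q′)`.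
[cite: Balaban1985BackgroundPropagators, (3.20)–(3.23) p.394, p.393] -/
theorem projR_map_comm_of_iso (Δs : E →ₗ[𝕜] E) (Q' : E →ₗ[𝕜] F') (σ : E → E)
    (hadd : ∀ x y, σ (x + y) = σ x + σ y) (hσ : ∀ x y : E, ⟪σ x, σ y⟫_𝕜 = ⟪x, y⟫_𝕜) (hσ2 : ∀ x, σ (σ x) = x)
    (hΔ : ∀ x, Δs (σ x) = σ (Δs x)) (hQ : ∀ l, Q' l = 0 → Q' (σ l) = 0) (x : E) :
    projR Δs Q' (σ x) = σ (projR Δs Q' x) := by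
  haveI : CompleteSpace ((LinearMap.ker Q').map Δs) := FiniteDimensional.complete 𝕜 _
  have hK : ∀ k ∈ (LinearMap.ker Q').map Δs, σ k ∈ (LinearMap.ker Q').map Δs := by
    intro k hk
    obtain ⟨l, hl, rfl⟩ := Submodule.mem_map.1 hk
    exact Submodule.mem_map.2 ⟨σ l, LinearMap.mem_ker.2 (hQ l (LinearMap.mem_ker.1 hl)), (hΔ l).symm ▸ rfl⟩
  exact starProjection_map_comm_of_iso _ σ hadd hσ hσ2 hK x

end Projection

/-! ## §4 The constructed operators `Δ_a`, `G₁`, `(QG₁Q*)⁻¹`, `H₁`, `𝔓`, `𝔊` -/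

section Operators

variable {𝕜 : Type*} [RCLike 𝕜] {E F S : Type*} [NormedAddCommGroup E] [InnerProductSpace 𝕜 E] [NormedAddCommGroup F] [InnerProductSpace 𝕜 F]
  [NormedAddCommGroup S] [InnerProductSpace 𝕜 S]
variable {Δ : E →ₗ[𝕜] E} {D : S →ₗ[𝕜] E} {R : S →ₗ[𝕜] S} {Dstar : E →ₗ[𝕜] S} {Q : E →ₗ[𝕜] F} {Qadj : F →ₗ[𝕜] E} {a : 𝕜}
variable {σE : E → E} {σS : S → S} {σF : F → F}

/-- a map respecting `+` respects `−` (used for the differences in `𝔓`, `𝔓*`). [folklore] -/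
private theorem map_sub_of_map_add {X : Type*} [AddCommGroup X] (σ : X → X) (hadd : ∀ x y, σ (x + y) = σ x + σ y) (x y : X) :
    σ (x - y) = σ x - σ y := by
  have h := hadd (x - y) y
  rw [sub_add_cancel] at h
  rw [h, add_sub_cancel_right]

/-- **`Δ_a = Δ + DRD* + Q*aQ` IS REAL WITH ITS DATA**: the data intertwine `σ_E, σ_S, σ_F`, `σ_E` is additive and `σ_F (a•y) = a•σ_F y` (for the
anti-linear conjugation: `a` real, as in print). [cite: Balaban1985Variational, (110) p.294, (51) p.286; Balaban1985BackgroundPropagators, (3.26) p.395] -/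
theorem laplaceAK_map_comm (hEadd : ∀ x y, σE (x + y) = σE x + σE y)
    (hΔ : ∀ x, Δ (σE x) = σE (Δ x)) (hD : ∀ s, D (σS s) = σE (D s)) (hR : ∀ s, R (σS s) = σS (R s)) (hDs : ∀ x, Dstar (σE x) = σS (Dstar x))
    (hQ : ∀ x, Q (σE x) = σF (Q x)) (hQa : ∀ y, Qadj (σF y) = σE (Qadj y)) (ha : ∀ y : F, σF (a • y) = a • σF y) (x : E) :
    laplaceAK Δ D R Dstar Q Qadj a (σE x) = σE (laplaceAK Δ D R Dstar Q Qadj a x) := by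
  rw [laplaceAK_apply, laplaceAK_apply, hΔ, hDs, hR, hD, hQ, ← ha, hQa, hEadd, hEadd]

variable [FiniteDimensional 𝕜 E]

/-- **`G₁ = Δ_a⁻¹` IS REAL WITH ITS DATA.** [cite: Balaban1985Variational, (110) p.294, (51) p.286; Balaban1985BackgroundPropagators, p.393] -/
theorem G1K_map_comm (hpos : ∀ x : E, x ≠ 0 → 0 < RCLike.re ⟪x, laplaceAK Δ D R Dstar Q Qadj a x⟫_𝕜)
    (hEadd : ∀ x y, σE (x + y) = σE x + σE y)
    (hΔ : ∀ x, Δ (σE x) = σE (Δ x)) (hD : ∀ s, D (σS s) = σE (D s)) (hR : ∀ s, R (σS s) = σS (R s)) (hDs : ∀ x, Dstar (σE x) = σS (Dstar x))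
    (hQ : ∀ x, Q (σE x) = σF (Q x)) (hQa : ∀ y, Qadj (σF y) = σE (Qadj y)) (ha : ∀ y : F, σF (a • y) = a • σF y) (x : E) :
    G1K Δ D R Dstar Q Qadj a hpos (σE x) = σE (G1K Δ D R Dstar Q Qadj a hpos x) :=
  greenK_map_comm hpos σE (laplaceAK_map_comm hEadd hΔ hD hR hDs hQ hQa ha) x

variable [FiniteDimensional 𝕜 F]

/-- **`(QG₁Q*)⁻¹` IS REAL WITH ITS DATA** (`Q*` injective, as in `KinvK`). [cite: Balaban1985Variational, (45) p.285, (51) p.286] -/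
theorem KinvK_map_comm (hpos : ∀ x : E, x ≠ 0 → 0 < RCLike.re ⟪x, laplaceAK Δ D R Dstar Q Qadj a x⟫_𝕜)
    (hadj : ∀ (x : E) (y : F), ⟪Q x, y⟫_𝕜 = ⟪x, Qadj y⟫_𝕜) (hQadj : Function.Injective Qadj)
    (hEadd : ∀ x y, σE (x + y) = σE x + σE y)
    (hΔ : ∀ x, Δ (σE x) = σE (Δ x)) (hD : ∀ s, D (σS s) = σE (D s)) (hR : ∀ s, R (σS s) = σS (R s)) (hDs : ∀ x, Dstar (σE x) = σS (Dstar x))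
    (hQ : ∀ x, Q (σE x) = σF (Q x)) (hQa : ∀ y, Qadj (σF y) = σE (Qadj y)) (ha : ∀ y : F, σF (a • y) = a • σF y) (y : F) :
    KinvK hpos hadj hQadj (σF y) = σF (KinvK hpos hadj hQadj y) := by
  unfold KinvK
  refine greenK_map_comm _ σF (fun z => ?_) y
  simp only [LinearMap.comp_apply]
  rw [hQa, G1K_map_comm hpos hEadd hΔ hD hR hDs hQ hQa ha, hQ]

/-- **`H₁ = G₁Q*(QG₁Q*)⁻¹` IS REAL WITH ITS DATA** — print's «for 𝔤-valued `B`, `H₁B` is 𝔤-valued».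
[cite: Balaban1985Variational, (45) p.285, (103) p.293, (51) p.286; Balaban1985BackgroundPropagators, (3.129) p.421, p.393] -/
theorem H1K_map_comm (hpos : ∀ x : E, x ≠ 0 → 0 < RCLike.re ⟪x, laplaceAK Δ D R Dstar Q Qadj a x⟫_𝕜)
    (hadj : ∀ (x : E) (y : F), ⟪Q x, y⟫_𝕜 = ⟪x, Qadj y⟫_𝕜) (hQadj : Function.Injective Qadj)
    (hEadd : ∀ x y, σE (x + y) = σE x + σE y)
    (hΔ : ∀ x, Δ (σE x) = σE (Δ x)) (hD : ∀ s, D (σS s) = σE (D s)) (hR : ∀ s, R (σS s) = σS (R s)) (hDs : ∀ x, Dstar (σE x) = σS (Dstar x))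
    (hQ : ∀ x, Q (σE x) = σF (Q x)) (hQa : ∀ y, Qadj (σF y) = σE (Qadj y)) (ha : ∀ y : F, σF (a • y) = a • σF y) (y : F) :
    H1K hpos hadj hQadj (σF y) = σE (H1K hpos hadj hQadj y) := by
  unfold H1K
  simp only [LinearMap.comp_apply]
  rw [KinvK_map_comm hpos hadj hQadj hEadd hΔ hD hR hDs hQ hQa ha, hQa, G1K_map_comm hpos hEadd hΔ hD hR hDs hQ hQa ha]

omit [FiniteDimensional 𝕜 E] [FiniteDimensional 𝕜 F] in
/-- **`𝔓 = I − G₁Q*(QG₁Q*)⁻¹Q − G₁DRD*` (3.147) IS REAL WITH ITS LETTERS** (letters `G₁`, `Kinv` as data here, cf. `G1K_map_comm` ∕ `KinvK_map_comm`).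
[cite: Balaban1985BackgroundPropagators, (3.147) p.425, p.393; Balaban1985Variational, (51) p.286] -/
theorem frakPLin_map_comm {G₁ : E →ₗ[𝕜] E} {Kinv : F →ₗ[𝕜] F} (hEadd : ∀ x y, σE (x + y) = σE x + σE y)
    (hG : ∀ x, G₁ (σE x) = σE (G₁ x)) (hK : ∀ y, Kinv (σF y) = σF (Kinv y))
    (hD : ∀ s, D (σS s) = σE (D s)) (hR : ∀ s, R (σS s) = σS (R s)) (hDs : ∀ x, Dstar (σE x) = σS (Dstar x))
    (hQ : ∀ x, Q (σE x) = σF (Q x)) (hQa : ∀ y, Qadj (σF y) = σE (Qadj y)) (x : E) :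
    frakPLin G₁ Q Qadj Kinv D R Dstar (σE x) = σE (frakPLin G₁ Q Qadj Kinv D R Dstar x) := by
  rw [frakPLin_apply, frakPLin_apply, hQ, hK, hQa, hG, hDs, hR, hD, hG, map_sub_of_map_add σE hEadd, map_sub_of_map_add σE hEadd]

omit [FiniteDimensional 𝕜 E] [FiniteDimensional 𝕜 F] in
/-- **`𝔊 = G₁𝔓*` (3.153) IS REAL WITH ITS LETTERS.** [cite: Balaban1985BackgroundPropagators, (3.153) p.426, p.393; Balaban1985Variational, (110)–(111) p.294, (51) p.286] -/
theorem frakGLin_map_comm {G₁ : E →ₗ[𝕜] E} {Kinv : F →ₗ[𝕜] F} (hEadd : ∀ x y, σE (x + y) = σE x + σE y)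
    (hG : ∀ x, G₁ (σE x) = σE (G₁ x)) (hK : ∀ y, Kinv (σF y) = σF (Kinv y))
    (hD : ∀ s, D (σS s) = σE (D s)) (hR : ∀ s, R (σS s) = σS (R s)) (hDs : ∀ x, Dstar (σE x) = σS (Dstar x))
    (hQ : ∀ x, Q (σE x) = σF (Q x)) (hQa : ∀ y, Qadj (σF y) = σE (Qadj y)) (x : E) :
    frakGLin G₁ Q Qadj Kinv D R Dstar (σE x) = σE (frakGLin G₁ Q Qadj Kinv D R Dstar x) := by
  rw [frakGLin_apply, frakGLin_apply, hG, hQ, hK, hQa, hG, hDs, hR, hD, hG, map_sub_of_map_add σE hEadd, map_sub_of_map_add σE hEadd]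

/-! ### Sector forms -/

omit [FiniteDimensional 𝕜 E] [FiniteDimensional 𝕜 F] in
/-- **`Δ_a` PRESERVES A SECTOR ITS DATA PRESERVE** (`V ⊆ E`, `V_S ⊆ S`, `V_F ⊆ F`). [cite: Balaban1985Variational, (110) p.294, (51) p.286] -/
theorem laplaceAK_mem_of_mapsTo (V : Submodule 𝕜 E) (VS : Submodule 𝕜 S) (VF : Submodule 𝕜 F)
    (hΔ : ∀ x ∈ V, Δ x ∈ V) (hD : ∀ s ∈ VS, D s ∈ V) (hR : ∀ s ∈ VS, R s ∈ VS) (hDs : ∀ x ∈ V, Dstar x ∈ VS)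
    (hQ : ∀ x ∈ V, Q x ∈ VF) (hQa : ∀ y ∈ VF, Qadj y ∈ V) {x : E} (hx : x ∈ V) :
    laplaceAK Δ D R Dstar Q Qadj a x ∈ V := by
  rw [laplaceAK_apply]
  exact V.add_mem (V.add_mem (hΔ x hx) (hD _ (hR _ (hDs x hx)))) (hQa _ (VF.smul_mem a (hQ x hx)))

omit [FiniteDimensional 𝕜 F] in
/-- **`G₁` PRESERVES A SECTOR ITS DATA PRESERVE.** [cite: Balaban1985Variational, (110) p.294, (51) p.286; Balaban1985BackgroundPropagators, p.393] -/
theorem G1K_mem_of_mapsTo (hpos : ∀ x : E, x ≠ 0 → 0 < RCLike.re ⟪x, laplaceAK Δ D R Dstar Q Qadj a x⟫_𝕜)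
    (V : Submodule 𝕜 E) (VS : Submodule 𝕜 S) (VF : Submodule 𝕜 F)
    (hΔ : ∀ x ∈ V, Δ x ∈ V) (hD : ∀ s ∈ VS, D s ∈ V) (hR : ∀ s ∈ VS, R s ∈ VS) (hDs : ∀ x ∈ V, Dstar x ∈ VS)
    (hQ : ∀ x ∈ V, Q x ∈ VF) (hQa : ∀ y ∈ VF, Qadj y ∈ V) {x : E} (hx : x ∈ V) :
    G1K Δ D R Dstar Q Qadj a hpos x ∈ V :=
  greenK_mem_of_mapsTo hpos V (fun _ hz => laplaceAK_mem_of_mapsTo V VS VF hΔ hD hR hDs hQ hQa hz) hx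

/-- **`(QG₁Q*)⁻¹` PRESERVES A SECTOR ITS DATA PRESERVE.** [cite: Balaban1985Variational, (45) p.285, (51) p.286] -/
theorem KinvK_mem_of_mapsTo (hpos : ∀ x : E, x ≠ 0 → 0 < RCLike.re ⟪x, laplaceAK Δ D R Dstar Q Qadj a x⟫_𝕜)
    (hadj : ∀ (x : E) (y : F), ⟪Q x, y⟫_𝕜 = ⟪x, Qadj y⟫_𝕜) (hQadj : Function.Injective Qadj)
    (V : Submodule 𝕜 E) (VS : Submodule 𝕜 S) (VF : Submodule 𝕜 F)
    (hΔ : ∀ x ∈ V, Δ x ∈ V) (hD : ∀ s ∈ VS, D s ∈ V) (hR : ∀ s ∈ VS, R s ∈ VS) (hDs : ∀ x ∈ V, Dstar x ∈ VS)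
    (hQ : ∀ x ∈ V, Q x ∈ VF) (hQa : ∀ y ∈ VF, Qadj y ∈ V) {y : F} (hy : y ∈ VF) :
    KinvK hpos hadj hQadj y ∈ VF := by
  unfold KinvK
  refine greenK_mem_of_mapsTo _ VF (fun z hz => ?_) hy
  simp only [LinearMap.comp_apply]
  exact hQ _ (G1K_mem_of_mapsTo hpos V VS VF hΔ hD hR hDs hQ hQa (hQa z hz))

/-- **`H₁` MAPS THE `F`-SECTOR INTO THE `E`-SECTOR** — the sector half of «`H₁B` is 𝔤-valued for 𝔤-valued `B`».
[cite: Balaban1985Variational, (45) p.285, (103) p.293, (51) p.286; Balaban1985BackgroundPropagators, (3.129) p.421] -/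
theorem H1K_mem_of_mapsTo (hpos : ∀ x : E, x ≠ 0 → 0 < RCLike.re ⟪x, laplaceAK Δ D R Dstar Q Qadj a x⟫_𝕜)
    (hadj : ∀ (x : E) (y : F), ⟪Q x, y⟫_𝕜 = ⟪x, Qadj y⟫_𝕜) (hQadj : Function.Injective Qadj)
    (V : Submodule 𝕜 E) (VS : Submodule 𝕜 S) (VF : Submodule 𝕜 F)
    (hΔ : ∀ x ∈ V, Δ x ∈ V) (hD : ∀ s ∈ VS, D s ∈ V) (hR : ∀ s ∈ VS, R s ∈ VS) (hDs : ∀ x ∈ V, Dstar x ∈ VS)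
    (hQ : ∀ x ∈ V, Q x ∈ VF) (hQa : ∀ y ∈ VF, Qadj y ∈ V) {y : F} (hy : y ∈ VF) :
    H1K hpos hadj hQadj y ∈ V := by
  unfold H1K
  simp only [LinearMap.comp_apply]
  exact G1K_mem_of_mapsTo hpos V VS VF hΔ hD hR hDs hQ hQa (hQa _ (KinvK_mem_of_mapsTo hpos hadj hQadj V VS VF hΔ hD hR hDs hQ hQa hy))

end Operators

/-! ## §5 Reading a sector through its reflection -/

section Reflection

variable {𝕜 : Type*} [RCLike 𝕜] {E F : Type*} [NormedAddCommGroup E] [InnerProductSpace 𝕜 E] [NormedAddCommGroup F] [InnerProductSpace 𝕜 F]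

/-- **A MAP INTERTWINING THE REFLECTIONS OF TWO SECTORS MAPS THE ONE INTO THE OTHER**: `T (ρ_V x) = ρ_{V′} (T x)` for all `x` and `v ∈ V` give
`ρ_{V′}(Tv) = Tv`, i.e. `Tv ∈ V′` — so the `_of_iso` lemmas at `σ := Submodule.reflection` yield the sector statements (for `T`, `T⁻¹`, `T†`, `R`).
[cite: Balaban1985Variational, (51) p.286; Balaban1985BackgroundPropagators, p.393] -/
theorem mem_of_reflection_comm (V : Submodule 𝕜 E) (V' : Submodule 𝕜 F) [V.HasOrthogonalProjection] [V'.HasOrthogonalProjection]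
    (T : E → F) (hT : ∀ x, T (V.reflection x) = V'.reflection (T x)) {v : E} (hv : v ∈ V) : T v ∈ V' := by
  rw [← Submodule.reflection_eq_self_iff, ← hT, Submodule.reflection_mem_subspace_eq_self hv]

/-- The reflection of a sector is a unitary additive involution (the three hypotheses of the `_of_iso` lemmas, discharged).
[cite: Balaban1985BackgroundPropagators, p.393] -/
theorem reflection_props (V : Submodule 𝕜 E) [V.HasOrthogonalProjection] :
    (∀ x y : E, V.reflection (x + y) = V.reflection x + V.reflection y) ∧
      (∀ x y : E, ⟪V.reflection x, V.reflection y⟫_𝕜 = ⟪x, y⟫_𝕜) ∧ (∀ x : E, V.reflection (V.reflection x) = x) :=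
  ⟨fun x y => map_add _ x y, fun x y => V.reflection.inner_map_map x y, fun x => V.reflection_reflection x⟩

end Reflection

end Literature.MathematicalPhysics.QuantumFieldTheory.Balaban1983to89.B11Eq103H1ComplexReality

end
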